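import Summits.RiemannHypothesis.RiemannHypothesis.Theorems.SignConeConeMagnificationPoissonCauchy
import Literature.Analysis.SpecialFunctions.DigammaVerticalSeries
import Literature.Analysis.SpecialFunctions.DigammaGauss
import Literature.NumberTheory.LFunctions.KadiriGammaRemainder

/-!
# `SignCone.ConeMagnification`, line `Sketch` (r4): the Poisson integral of `Re ψ(1/4 + iv/2)` — the r3⇔r4 bridge
(crux stmt-RiemannHypothesis-16303; HELPER file, `--supports`; registered sub-goal `poissonArchBridge`)

Skeleton r4 of the line (`Cruxes/ConeMagnification/Lines/Sketch.lean`) states the Carathéodory majorant of the one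
open stub `stub_torusOfCara` with the archimedean term in POISSON FORM,

  `𝒜(s) = (1/2π) ∫_ℝ Re ψ(1/4 + iv/2) · (σ − 1/2)/((σ − 1/2)² + (t − v)²) dv`   (`s = σ + it`, `σ > 1/2`),

which is what the landed `stub_cara` delivers (Laplace transform of the archimedean piece of translates,
`re_laplace_weilArchTerm_weilTranslate`), whereas skeleton r3 — and the landed special cases of the open core
(`torusOfCara_of_eventually_vonMangoldt`, p133361; `torusOfCara_of_summable`, p133660) and its calibration
(`exists_large_re_riemannZeta0_of_stub_torusOfCara`, p132538) — have `½ Re ψ(s/2)`.  THIS FILE PROVES THE TWO AGREE: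

  `poissonArch_eq_half_re_digamma` :  `𝒜(s) = ½ Re ψ(s/2)`  for `Re s > 1/2`,

i.e. `Re ψ(s/2)` is the Poisson extension to the half-plane `Re s > 1/2` of its (continuous, logarithmically growing)
boundary values on `Re s = 1/2` (`integral_re_digamma_quarter_mul_poisson`).  So the r4 stub is literally equivalent
to the r3 stub, and everything proved about the r3 form transfers (`…TorusPoisson.lean`).

Proof.  By Andrews–Askey–Roy (1.2.13) (`hasSum_one_div_sub_one_div_digamma` in the tree), for `x₀ ≥ 0`,
`Re ψ(1/4 + x₀/2 + it/2) + γ = Σ_k [1/(k+1) − 2(a_k + x₀)/((a_k + x₀)² + t²)]`, `a_k = 2k + 1/2`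
(`hasSum_re_digamma_quarter`).  The Poisson integral (height `x₀`, point `t`) of the `k`-th boundary term
`g_k(v) = 1/(k+1) − 2a_k/(a_k² + v²)` is `π [1/(k+1) − 2(a_k + x₀)/((a_k + x₀)² + t²)]` by the Cauchy–Poisson semigroup law
(`integral_cauchy_mul_poisson`, file `…PoissonCauchy.lean`) — the `k`-th term at height `x₀`
(`integral_digammaTerm_mul_poisson`).  Interchange of `Σ_k` and `∫`: `g_k(v) = (v² − (3/2)a_k)/((k+1)(a_k² + v²))`, so
`∫ |g_k| P ≤ π/(k+1) · ((a_k+x₀)(x₀+3/2) + t²)/((a_k+x₀)² + t²) ≤ π(2x₀ + 3 + 4t²)/(k+1)²` (again by the exact semigroup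
integrals; `integral_norm_digammaTerm_mul_poisson_le`), summable, and `integral_tsum_of_summable_integral_norm` applies.
Integrability of `Re ψ(1/4+iv/2) P(v)` itself: majorant `(log(3+|v|) + 12) P(v)` (`KadiriGamma.abs_re_digamma_le`,
`KadiriGamma.integrable_T2_majorant`).
-/

noncomputable section

-- `Summit.RiemannHypothesis.RiemannHypothesis.…` repeats a namespace component by design (D-0017 layout).
set_option linter.dupNamespace false

open Real Filter MeasureTheory Set
open scoped Topology

namespace Summit.RiemannHypothesis.RiemannHypothesis.Theorems.SignConeConeMagnification

open Complex in
/-- **The AAR series for `Re ψ` on the quarter-shifted vertical lines.**  For `x₀ ≥ 0` and real `t`,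
`Re ψ(1/4 + x₀/2 + it/2) + γ = Σ_{k≥0} [1/(k+1) − 2(2k + 1/2 + x₀)/((2k + 1/2 + x₀)² + t²)]`
(Andrews–Askey–Roy (1.2.13) `ψ(w) + γ = Σ (1/(k+1) − 1/(w+k))`, real parts, `Re 1/(w+k) = 2(a_k+x₀)/((a_k+x₀)²+t²)`,
`a_k = 2k + 1/2`). [cite: AndrewsAskeyRoy1999, Thm 1.2.5 (1.2.13)] -/
theorem hasSum_re_digamma_quarter {x₀ : ℝ} (hx₀ : 0 ≤ x₀) (t : ℝ) :
    HasSum (fun k : ℕ => 1 / ((k : ℝ) + 1) - 2 * (2 * k + 1 / 2 + x₀) / ((2 * k + 1 / 2 + x₀) ^ 2 + t ^ 2))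
      ((Complex.digamma (1 / 4 + (x₀ : ℂ) / 2 + (t : ℂ) / 2 * I)).re + Real.eulerMascheroniConstant) := by
  set w : ℂ := 1 / 4 + (x₀ : ℂ) / 2 + (t : ℂ) / 2 * I with hw_def
  have hw : 0 < w.re := by
    simp [hw_def]
    linarith
  have h := (Literature.Analysis.SpecialFunctions.Complex.hasSum_one_div_sub_one_div_digamma hw).mapL Complex.reCLM
  simp only [Complex.reCLM_apply, add_re, ofReal_re] at h
  refine h.congr_fun fun k => ?_
  have hre : (w + k).re = (2 * k + 1 / 2 + x₀) / 2 := by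
    simp [hw_def]
    ring
  have him : (w + k).im = t / 2 := by simp [hw_def]
  have hpos : 0 < 2 * (k : ℝ) + 1 / 2 + x₀ := by positivity
  have hns : Complex.normSq (w + k) = ((2 * k + 1 / 2 + x₀) / 2) ^ 2 + (t / 2) ^ 2 := by
    rw [Complex.normSq_apply, hre, him]
    ring
  have h1 : (1 / ((k : ℂ) + 1)).re = 1 / ((k : ℝ) + 1) := by
    rw [show (k : ℂ) + 1 = (((k : ℝ) + 1 : ℝ) : ℂ) by push_cast; ring, ← ofReal_one, ← ofReal_div, ofReal_re]
  have h2 : (1 / (w + k)).re = 2 * (2 * k + 1 / 2 + x₀) / ((2 * k + 1 / 2 + x₀) ^ 2 + t ^ 2) := by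
    rw [one_div, Complex.inv_re, hre, hns]
    have hD : ((2 * (k : ℝ) + 1 / 2 + x₀) / 2) ^ 2 + (t / 2) ^ 2 ≠ 0 := by positivity
    have hD' : (2 * (k : ℝ) + 1 / 2 + x₀) ^ 2 + t ^ 2 ≠ 0 := by positivity
    field_simp
  rw [sub_re, h1, h2]

variable {x₀ : ℝ}

/-- The `k`-th term of the boundary series: `g_k(v) = 1/(k+1) − 2a_k/(a_k² + v²)`, `a_k = 2k + 1/2`, integrated against
the Poisson kernel: `∫ g_k(v) · x₀/(x₀² + (t−v)²) dv = π [1/(k+1) − 2(a_k + x₀)/((a_k + x₀)² + t²)]`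
(Poisson mass `π` and the Cauchy–Poisson semigroup law). [folklore] -/
theorem integral_digammaTerm_mul_poisson (hx₀ : 0 < x₀) (t : ℝ) (k : ℕ) :
    ∫ v : ℝ, (1 / ((k : ℝ) + 1) - 2 * (2 * k + 1 / 2) / ((2 * k + 1 / 2) ^ 2 + v ^ 2)) * (x₀ / (x₀ ^ 2 + (t - v) ^ 2)) =
      Real.pi * (1 / ((k : ℝ) + 1) - 2 * (2 * k + 1 / 2 + x₀) / ((2 * k + 1 / 2 + x₀) ^ 2 + t ^ 2)) := by
  have ha : (0 : ℝ) < 2 * k + 1 / 2 := by positivity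
  have hP := integrable_poisson hx₀ t
  have hCP := integrable_cauchy_mul_poisson ha hx₀ t
  have e : ∀ v : ℝ, (1 / ((k : ℝ) + 1) - 2 * (2 * k + 1 / 2) / ((2 * k + 1 / 2) ^ 2 + v ^ 2)) *
      (x₀ / (x₀ ^ 2 + (t - v) ^ 2)) =
      1 / ((k : ℝ) + 1) * (x₀ / (x₀ ^ 2 + (t - v) ^ 2)) -
        2 * ((2 * k + 1 / 2) / ((2 * k + 1 / 2) ^ 2 + v ^ 2) * (x₀ / (x₀ ^ 2 + (t - v) ^ 2))) := by
    intro v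
    ring
  simp_rw [e]
  rw [integral_sub (hP.const_mul _) (hCP.const_mul _), integral_const_mul, integral_const_mul,
    integral_poisson hx₀ t, integral_cauchy_mul_poisson ha hx₀ t]
  have hD : (2 * (k : ℝ) + 1 / 2 + x₀) ^ 2 + t ^ 2 ≠ 0 := by positivity
  field_simp

/-- Pointwise bound for the `k`-th term: `|g_k(v)| ≤ (v² + (3/2)a_k)/((k+1)(a_k² + v²))`, in the linear form
`|g_k(v)| · P(v) ≤ P(v)/(k+1) + ((3/2 − a_k)/(k+1)) · (a_k/(a_k²+v²)) P(v)` (`g_k(v) = (v² − (3/2)a_k)/((k+1)(a_k²+v²))`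
since `2a_k(k+1) = a_k(a_k + 3/2)`). [folklore] -/
theorem norm_digammaTerm_mul_poisson_le (hx₀ : 0 < x₀) (t : ℝ) (k : ℕ) (v : ℝ) :
    ‖(1 / ((k : ℝ) + 1) - 2 * (2 * k + 1 / 2) / ((2 * k + 1 / 2) ^ 2 + v ^ 2)) * (x₀ / (x₀ ^ 2 + (t - v) ^ 2))‖ ≤
      1 / ((k : ℝ) + 1) * (x₀ / (x₀ ^ 2 + (t - v) ^ 2)) +
        (3 / 2 - (2 * k + 1 / 2)) / ((k : ℝ) + 1) *
          ((2 * k + 1 / 2) / ((2 * k + 1 / 2) ^ 2 + v ^ 2) * (x₀ / (x₀ ^ 2 + (t - v) ^ 2))) := by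
  set a : ℝ := 2 * k + 1 / 2 with ha_def
  have ha : 0 < a := by positivity
  have hk : (0 : ℝ) < (k : ℝ) + 1 := by positivity
  have hA : 0 < a ^ 2 + v ^ 2 := by positivity
  have hP0 : 0 ≤ x₀ / (x₀ ^ 2 + (t - v) ^ 2) := by positivity
  set g : ℝ := 1 / ((k : ℝ) + 1) - 2 * a / (a ^ 2 + v ^ 2) with hg_def
  set B : ℝ := (v ^ 2 + 3 / 2 * a) / (((k : ℝ) + 1) * (a ^ 2 + v ^ 2)) with hB_def
  -- `|g| ≤ B`
  have hgB : |g| ≤ B := by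
    rw [abs_le]
    constructor
    · have h : B + g = 2 * v ^ 2 / (((k : ℝ) + 1) * (a ^ 2 + v ^ 2)) := by
        rw [hB_def, hg_def, ha_def]
        field_simp
        ring
      have h' : 0 ≤ B + g := by rw [h]; positivity
      linarith
    · have h : B - g = 3 * a / (((k : ℝ) + 1) * (a ^ 2 + v ^ 2)) := by
        rw [hB_def, hg_def, ha_def]
        field_simp
        ring
      have h' : 0 ≤ B - g := by rw [h]; positivity
      linarith
  -- the right-hand side equals `B · P`
  have hRHS : 1 / ((k : ℝ) + 1) * (x₀ / (x₀ ^ 2 + (t - v) ^ 2)) +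
      (3 / 2 - a) / ((k : ℝ) + 1) * (a / (a ^ 2 + v ^ 2) * (x₀ / (x₀ ^ 2 + (t - v) ^ 2))) =
      B * (x₀ / (x₀ ^ 2 + (t - v) ^ 2)) := by
    rw [hB_def]
    field_simp
    ring
  rw [hRHS, norm_mul, Real.norm_of_nonneg hP0, Real.norm_eq_abs]
  exact mul_le_mul_of_nonneg_right hgB hP0

/-- Integrability of the `k`-th term against the Poisson kernel. [folklore] -/
theorem integrable_digammaTerm_mul_poisson (hx₀ : 0 < x₀) (t : ℝ) (k : ℕ) :
    Integrable fun v : ℝ =>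
      (1 / ((k : ℝ) + 1) - 2 * (2 * k + 1 / 2) / ((2 * k + 1 / 2) ^ 2 + v ^ 2)) * (x₀ / (x₀ ^ 2 + (t - v) ^ 2)) := by
  have ha : (0 : ℝ) < 2 * k + 1 / 2 := by positivity
  have hP := integrable_poisson hx₀ t
  have hCP := integrable_cauchy_mul_poisson ha hx₀ t
  have e : (fun v : ℝ => (1 / ((k : ℝ) + 1) - 2 * (2 * k + 1 / 2) / ((2 * k + 1 / 2) ^ 2 + v ^ 2)) *
      (x₀ / (x₀ ^ 2 + (t - v) ^ 2))) =
      fun v => 1 / ((k : ℝ) + 1) * (x₀ / (x₀ ^ 2 + (t - v) ^ 2)) -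
        2 * ((2 * k + 1 / 2) / ((2 * k + 1 / 2) ^ 2 + v ^ 2) * (x₀ / (x₀ ^ 2 + (t - v) ^ 2))) := by
    funext v
    ring
  rw [e]
  exact (hP.const_mul _).sub (hCP.const_mul _)

/-- **The `L¹` bound for the `k`-th term**:
`∫ |g_k(v)| P(v) dv ≤ π/(k+1) + ((3/2 − a_k)/(k+1)) · π(a_k + x₀)/((a_k + x₀)² + t²)`, and this is `≤ π(2x₀ + 3 + 4t²)/(k+1)²`. [folklore] -/
theorem integral_norm_digammaTerm_mul_poisson_le (hx₀ : 0 < x₀) (t : ℝ) (k : ℕ) :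
    ∫ v : ℝ, ‖(1 / ((k : ℝ) + 1) - 2 * (2 * k + 1 / 2) / ((2 * k + 1 / 2) ^ 2 + v ^ 2)) *
        (x₀ / (x₀ ^ 2 + (t - v) ^ 2))‖ ≤ Real.pi * (2 * x₀ + 3 + 4 * t ^ 2) / ((k : ℝ) + 1) ^ 2 := by
  set a : ℝ := 2 * k + 1 / 2 with ha_def
  have ha : 0 < a := by positivity
  have hk : (0 : ℝ) < (k : ℝ) + 1 := by positivity
  have hP := integrable_poisson hx₀ t
  have hCP := integrable_cauchy_mul_poisson ha hx₀ t
  -- integrate the pointwise majorant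
  have h1 : ∫ v : ℝ, ‖(1 / ((k : ℝ) + 1) - 2 * (2 * k + 1 / 2) / ((2 * k + 1 / 2) ^ 2 + v ^ 2)) *
        (x₀ / (x₀ ^ 2 + (t - v) ^ 2))‖ ≤
      ∫ v : ℝ, (1 / ((k : ℝ) + 1) * (x₀ / (x₀ ^ 2 + (t - v) ^ 2)) +
        (3 / 2 - a) / ((k : ℝ) + 1) * (a / (a ^ 2 + v ^ 2) * (x₀ / (x₀ ^ 2 + (t - v) ^ 2)))) := by
    refine integral_mono (integrable_digammaTerm_mul_poisson hx₀ t k).norm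
      ((hP.const_mul _).add (hCP.const_mul _)) fun v => ?_
    exact norm_digammaTerm_mul_poisson_le hx₀ t k v
  have h2 : ∫ v : ℝ, (1 / ((k : ℝ) + 1) * (x₀ / (x₀ ^ 2 + (t - v) ^ 2)) +
        (3 / 2 - a) / ((k : ℝ) + 1) * (a / (a ^ 2 + v ^ 2) * (x₀ / (x₀ ^ 2 + (t - v) ^ 2)))) =
      Real.pi / ((k : ℝ) + 1) * (((a + x₀) * (x₀ + 3 / 2) + t ^ 2) / ((a + x₀) ^ 2 + t ^ 2)) := by
    rw [integral_add (hP.const_mul _) (hCP.const_mul _), integral_const_mul, integral_const_mul,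
      integral_poisson hx₀ t, integral_cauchy_mul_poisson ha hx₀ t]
    have hD : (a + x₀) ^ 2 + t ^ 2 ≠ 0 := by positivity
    field_simp
    ring
  -- the elementary bound
  have hax : (k + 1 : ℝ) / 2 ≤ a + x₀ := by rw [ha_def]; linarith
  have hax0 : 0 < a + x₀ := by positivity
  have hN0 : 0 ≤ (a + x₀) * (x₀ + 3 / 2) + t ^ 2 := by positivity
  have h3 : ((a + x₀) * (x₀ + 3 / 2) + t ^ 2) / ((a + x₀) ^ 2 + t ^ 2) ≤
      (x₀ + 3 / 2) / (a + x₀) + t ^ 2 / (a + x₀) ^ 2 := by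
    calc ((a + x₀) * (x₀ + 3 / 2) + t ^ 2) / ((a + x₀) ^ 2 + t ^ 2)
        ≤ ((a + x₀) * (x₀ + 3 / 2) + t ^ 2) / (a + x₀) ^ 2 :=
          div_le_div_of_nonneg_left hN0 (by positivity) (by nlinarith [sq_nonneg t])
      _ = (x₀ + 3 / 2) / (a + x₀) + t ^ 2 / (a + x₀) ^ 2 := by
          field_simp
  have h4 : (x₀ + 3 / 2) / (a + x₀) ≤ (x₀ + 3 / 2) * (2 / ((k : ℝ) + 1)) := by
    rw [div_eq_mul_one_div]
    refine mul_le_mul_of_nonneg_left ?_ (by positivity)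
    rw [div_le_div_iff₀ hax0 hk]
    linarith
  have h5 : t ^ 2 / (a + x₀) ^ 2 ≤ t ^ 2 * (4 / ((k : ℝ) + 1) ^ 2) := by
    rw [div_eq_mul_one_div]
    refine mul_le_mul_of_nonneg_left ?_ (by positivity)
    rw [div_le_div_iff₀ (by positivity) (by positivity)]
    nlinarith [hax, hk.le]
  have h6 : Real.pi / ((k : ℝ) + 1) * (((a + x₀) * (x₀ + 3 / 2) + t ^ 2) / ((a + x₀) ^ 2 + t ^ 2)) ≤
      Real.pi * (2 * x₀ + 3 + 4 * t ^ 2) / ((k : ℝ) + 1) ^ 2 := by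
    have hk1 : 1 ≤ (k : ℝ) + 1 := by linarith [hk]
    calc Real.pi / ((k : ℝ) + 1) * (((a + x₀) * (x₀ + 3 / 2) + t ^ 2) / ((a + x₀) ^ 2 + t ^ 2))
        ≤ Real.pi / ((k : ℝ) + 1) * ((x₀ + 3 / 2) * (2 / ((k : ℝ) + 1)) + t ^ 2 * (4 / ((k : ℝ) + 1) ^ 2)) :=
          mul_le_mul_of_nonneg_left (h3.trans (add_le_add h4 h5)) (by positivity)
      _ = Real.pi * (2 * x₀ + 3) / ((k : ℝ) + 1) ^ 2 + Real.pi * (4 * t ^ 2) / ((k : ℝ) + 1) ^ 3 := by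
          field_simp
      _ ≤ Real.pi * (2 * x₀ + 3) / ((k : ℝ) + 1) ^ 2 + Real.pi * (4 * t ^ 2) / ((k : ℝ) + 1) ^ 2 := by
          have h7 : Real.pi * (4 * t ^ 2) / ((k : ℝ) + 1) ^ 3 ≤ Real.pi * (4 * t ^ 2) / ((k : ℝ) + 1) ^ 2 :=
            div_le_div_of_nonneg_left (by positivity) (by positivity) (pow_le_pow_right₀ hk1 (by norm_num))
          linarith
      _ = Real.pi * (2 * x₀ + 3 + 4 * t ^ 2) / ((k : ℝ) + 1) ^ 2 := by ring
  exact h1.trans (h2.le.trans h6)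

/-- **The Poisson integral of `Re ψ(1/4 + iv/2)`**: for `x₀ > 0` and real `t`,
`∫_ℝ Re ψ(1/4 + iv/2) · x₀/(x₀² + (t − v)²) dv = π · Re ψ(1/4 + x₀/2 + it/2)`, i.e. `Re ψ(s/2)` is the Poisson
extension to `Re s > 1/2` of its boundary values on `Re s = 1/2` (termwise on the AAR series, each term by the
Cauchy–Poisson semigroup law; interchange by `Σ_k ∫ |g_k| P < ∞`; integrability of `Re ψ(1/4+iv/2) P(v)` from the
majorant `log(3+|v|) + 12` of `KadiriGamma.abs_re_digamma_le`). [folklore] -/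
theorem integral_re_digamma_quarter_mul_poisson (hx₀ : 0 < x₀) (t : ℝ) :
    ∫ v : ℝ, (Complex.digamma (1 / 4 + (v : ℂ) / 2 * Complex.I)).re * (x₀ / (x₀ ^ 2 + (t - v) ^ 2)) =
      Real.pi * (Complex.digamma (1 / 4 + (x₀ : ℂ) / 2 + (t : ℂ) / 2 * Complex.I)).re := by
  set γ : ℝ := Real.eulerMascheroniConstant with hγ
  set F : ℕ → ℝ → ℝ := fun k v =>
    (1 / ((k : ℝ) + 1) - 2 * (2 * k + 1 / 2) / ((2 * k + 1 / 2) ^ 2 + v ^ 2)) * (x₀ / (x₀ ^ 2 + (t - v) ^ 2))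
    with hF
  have hP := integrable_poisson hx₀ t
  -- pointwise: `Σ_k F k v = (Re ψ(1/4+iv/2) + γ) P(v)`
  have hpt : ∀ v : ℝ, HasSum (fun k => F k v)
      (((Complex.digamma (1 / 4 + (v : ℂ) / 2 * Complex.I)).re + γ) * (x₀ / (x₀ ^ 2 + (t - v) ^ 2))) := by
    intro v
    have h := (hasSum_re_digamma_quarter le_rfl v).mul_right (x₀ / (x₀ ^ 2 + (t - v) ^ 2))
    simp only [Complex.ofReal_zero, zero_div, add_zero] at h
    refine h.congr_fun fun k => ?_
    simp only [hF]
  -- interchange of sum and integral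
  have hint : ∀ k, Integrable (F k) := fun k => integrable_digammaTerm_mul_poisson hx₀ t k
  have hsum : Summable fun k => ∫ v, ‖F k v‖ := by
    have hb : Summable fun k : ℕ => Real.pi * (2 * x₀ + 3 + 4 * t ^ 2) / ((k : ℝ) + 1) ^ 2 := by
      have h2 : Summable (fun k : ℕ => 1 / ((k : ℝ) + 1) ^ 2) := by
        have h := (Real.summable_one_div_nat_pow.2 one_lt_two)
        exact_mod_cast (summable_nat_add_iff 1).2 h
      refine (h2.mul_left (Real.pi * (2 * x₀ + 3 + 4 * t ^ 2))).congr fun k => ?_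
      field_simp
    refine Summable.of_nonneg_of_le (fun k => integral_nonneg fun v => norm_nonneg _) (fun k => ?_) hb
    simp only [hF]
    exact integral_norm_digammaTerm_mul_poisson_le hx₀ t k
  have hswap := integral_tsum_of_summable_integral_norm hint hsum
  -- the left side of the interchange: `Σ_k ∫ F k = π (Re ψ(w) + γ)`
  have hlhs : ∑' k, ∫ v : ℝ, F k v =
      Real.pi * ((Complex.digamma (1 / 4 + (x₀ : ℂ) / 2 + (t : ℂ) / 2 * Complex.I)).re + γ) := by
    have h := (hasSum_re_digamma_quarter hx₀.le t).mul_left Real.pi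
    rw [← h.tsum_eq]
    refine tsum_congr fun k => ?_
    simp only [hF]
    exact integral_digammaTerm_mul_poisson hx₀ t k
  -- the right side: `∫ Σ_k F k = ∫ (Re ψ(1/4+iv/2) + γ) P`
  have hrhs : ∫ v : ℝ, ∑' k, F k v = ∫ v : ℝ, ((Complex.digamma (1 / 4 + (v : ℂ) / 2 * Complex.I)).re + γ) *
      (x₀ / (x₀ ^ 2 + (t - v) ^ 2)) :=
    integral_congr_ae (Eventually.of_forall fun v => (hpt v).tsum_eq)
  -- integrability of `Re ψ(1/4+iv/2) P(v)` (majorant `(log(3+|v|) + 12) P(v)`)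
  have hψc : Continuous fun v : ℝ => (Complex.digamma (1 / 4 + v / 2 * Complex.I)).re :=
    Literature.Analysis.SpecialFunctions.continuous_reDigammaQuarter
  have hψb : ∀ v : ℝ, |(Complex.digamma (1 / 4 + v / 2 * Complex.I)).re| ≤ Real.log (3 + |v|) + 12 := by
    intro v
    have h := Literature.NumberTheory.LFunctions.KadiriGamma.abs_re_digamma_le v
    have e : ((((1 / 2 : ℝ)) : ℂ) + v * Complex.I) / 2 = 1 / 4 + v / 2 * Complex.I := by push_cast; ring
    rwa [e] at h
  have hPc : Continuous fun v : ℝ => x₀ / (x₀ ^ 2 + (t - v) ^ 2) :=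
    Continuous.div continuous_const (by fun_prop) fun v => by positivity
  have hIψ : Integrable fun v : ℝ =>
      (Complex.digamma (1 / 4 + (v : ℂ) / 2 * Complex.I)).re * (x₀ / (x₀ ^ 2 + (t - v) ^ 2)) := by
    refine (Literature.NumberTheory.LFunctions.KadiriGamma.integrable_T2_majorant (t := t) hx₀
      (by norm_num : (0 : ℝ) ≤ 12) hx₀.le).mono' (hψc.mul hPc).aestronglyMeasurable
      (Eventually.of_forall fun v => ?_)
    have hP0 : 0 ≤ x₀ / (x₀ ^ 2 + (t - v) ^ 2) := by positivity
    rw [Real.norm_eq_abs, abs_mul, abs_of_nonneg hP0]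
    exact mul_le_mul_of_nonneg_right (hψb v) hP0
  -- assemble
  have hsplit : ∫ v : ℝ, ((Complex.digamma (1 / 4 + (v : ℂ) / 2 * Complex.I)).re + γ) *
      (x₀ / (x₀ ^ 2 + (t - v) ^ 2)) =
      (∫ v : ℝ, (Complex.digamma (1 / 4 + (v : ℂ) / 2 * Complex.I)).re * (x₀ / (x₀ ^ 2 + (t - v) ^ 2))) +
        γ * Real.pi := by
    have e : ∀ v : ℝ, ((Complex.digamma (1 / 4 + (v : ℂ) / 2 * Complex.I)).re + γ) *
        (x₀ / (x₀ ^ 2 + (t - v) ^ 2)) =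
        (Complex.digamma (1 / 4 + (v : ℂ) / 2 * Complex.I)).re * (x₀ / (x₀ ^ 2 + (t - v) ^ 2)) +
          γ * (x₀ / (x₀ ^ 2 + (t - v) ^ 2)) := fun v => by ring
    simp_rw [e]
    rw [integral_add hIψ (hP.const_mul γ), integral_const_mul, integral_poisson hx₀ t]
  have key : (∫ v : ℝ, (Complex.digamma (1 / 4 + (v : ℂ) / 2 * Complex.I)).re *
      (x₀ / (x₀ ^ 2 + (t - v) ^ 2))) + γ * Real.pi =
      Real.pi * ((Complex.digamma (1 / 4 + (x₀ : ℂ) / 2 + (t : ℂ) / 2 * Complex.I)).re + γ) := by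
    rw [← hsplit, ← hrhs, ← hswap, hlhs]
  linarith

/-- **The bridge between skeletons r3 and r4 of the line**: for `Re s > 1/2` the Poisson form of the archimedean
majorant equals `½ Re ψ(s/2)`:
`(1/2π) ∫ Re ψ(1/4 + iv/2) · (σ − 1/2)/((σ − 1/2)² + (t − v)²) dv = ½ Re ψ(s/2)` (`s = σ + it`). [folklore] -/
theorem poissonArch_eq_half_re_digamma {s : ℂ} (hs : 1 / 2 < s.re) :
    1 / (2 * Real.pi) * (∫ v : ℝ, (Complex.digamma (1 / 4 + v / 2 * Complex.I)).re *
        ((s.re - 1 / 2) / ((s.re - 1 / 2) ^ 2 + (s.im - v) ^ 2))) = (Complex.digamma (s / 2)).re / 2 := by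
  have hx₀ : 0 < s.re - 1 / 2 := by linarith
  have h := integral_re_digamma_quarter_mul_poisson hx₀ s.im
  have hs2 : (1 / 4 + ((s.re - 1 / 2 : ℝ) : ℂ) / 2 + ((s.im : ℝ) : ℂ) / 2 * Complex.I) = s / 2 := by
    apply Complex.ext
    · simp
      ring
    · simp
  rw [hs2] at h
  rw [h]
  have hπ : Real.pi ≠ 0 := Real.pi_pos.ne'
  field_simp

/-- **Registered sub-goal form** (closed statement) of the r3⇔r4 bridge `poissonArch_eq_half_re_digamma`. [folklore] -/
theorem poissonArchBridge :
    ∀ s : ℂ, 1 / 2 < s.re →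
      1 / (2 * Real.pi) * (∫ v : ℝ, (Complex.digamma (1 / 4 + v / 2 * Complex.I)).re *
        ((s.re - 1 / 2) / ((s.re - 1 / 2) ^ 2 + (s.im - v) ^ 2))) = (Complex.digamma (s / 2)).re / 2 :=
  fun _ hs => poissonArch_eq_half_re_digamma hs

end Summit.RiemannHypothesis.RiemannHypothesis.Theorems.SignConeConeMagnification

end
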